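import Summits.QuantumAdvantage.QuantumAdvantage.Theorems.WbwVerifiableLineNoSpeedup.Negative.AdversaryLine

/-!
# The adversary counts, II: the acquire count `≤ T` and the degree count `≥ T (2^m/2 - 2T - 1)`

Sequel to `AdversaryLine.lean` (crux `WhiteBoxWalk.WbwVerifiableLineNoSpeedup`, stmt-QuantumAdvantage-2239,
work file `Disproof.lean` §7.1). (a) ACQUIRE: the partners of an end acquiring a name `x` as `i`-th
vertex (`x ≠ x_i`) are at most `T` — one `v` per `k`, `v = σ^{-(i-k)} x`, by the uniform line
formula. (b) DEGREE: for `σ` in either side, the injection `(k, w) ↦ σ * swap x_k v`,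
`v = σ^{-(T-k)} w`, `k < T`, `w` of the opposite parity outside the first `2T+1` line vertices
(`pref`): the partner stays in the long-cycle family (`PermInstances.noReturn_transpose`; both
distance hypotheses reduce to `w ∉ pref`), its sink is `w`, it is adjacent, and `(k, w)` is
recovered from it; with `#{names of a parity} = 2^(m-1)` this is the degree count of Ambainis's
datum on both sides (`degree_fst`, `degree_snd`). Sorry-free.
-/

noncomputable section

set_option linter.dupNamespace false

namespace Summit.QuantumAdvantage.QuantumAdvantage.Theorems.WbwVerifiableLineNoSpeedup.Negative.Adversary

open Finset Literature.Computability.Cryptography Literature.Computability.QuantumComplexity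
  Literature.Computability.Complexity
open Summit.QuantumAdvantage.QuantumAdvantage.Theorems.WbwVerifiableLineNoSpeedup.Negative.PermInstances

variable {m T : ℕ}

/-- **Count: partners of `σ` ACQUIRING `x` as `i`-th vertex (`x ≠ x_i(σ)`) are at most `T`**
(one `v` per `k`, by the uniform line formula). [folklore] -/
theorem card_partners_fst_acquire_le {σ : Equiv.Perm (Fin (2 ^ m))} (hσ : NoReturn T σ)
    (x : Fin (2 ^ m)) (i : Fin (T + 1)) (hx : (σ ^ i.val) (src0 m) ≠ x) :
    #((Rp m T).filter fun q => q.1 = σ ∧ (q.2 ^ i.val) (src0 m) = x) ≤ T := by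
  classical
  have key : ∀ q ∈ (Rp m T).filter (fun q => q.1 = σ ∧ (q.2 ^ i.val) (src0 m) = x),
      ∃ k : Fin T, k.val < i.val ∧
        q.2 = transpose σ ((σ ^ k.val) (src0 m)) ((σ ^ (i.val - k.val)).symm x) := by
    intro q hq
    rw [Finset.mem_filter, mem_Rp_iff] at hq
    obtain ⟨⟨-, hy, hadj⟩, rfl, hxi⟩ := hq
    obtain ⟨k, hk, v, hv, hq2⟩ := hadj
    have hσ'' : NoReturn T (transpose q.1 ((q.1 ^ k) (src0 m)) v) := hq2 ▸ noReturn_of_mem_Yp hy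
    -- k < i (else the prefix is unchanged)
    have hki : k < i.val := by
      by_contra hle
      push Not at hle
      apply hx
      rw [← hxi, hq2]
      exact (pow_transpose_prefix hσ.atZero hk.le hv i.val hle).symm
    refine ⟨⟨k, hk⟩, hki, ?_⟩
    -- line formula: x = x_i(q.2) = σ^(i-k) v
    have hlf := line_formula hσ hk.le hv hσ'' (i.val - k) (by omega) (by have := i.isLt; omega)
    rw [show k + (i.val - k) = i.val by omega, ← hq2, hxi] at hlf
    -- v = (σ^(i-k))⁻¹ x
    rw [hq2]
    congr 1
    rw [eq_comm, Equiv.symm_apply_eq]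
    exact hlf
  rcases Nat.eq_zero_or_pos T with hT0 | hTpos
  · subst hT0; rw [Rp_zero]; simp
  haveI : Nonempty (Fin T) := ⟨⟨0, hTpos⟩⟩
  choose! f hf using key
  calc #((Rp m T).filter fun q => q.1 = σ ∧ (q.2 ^ i.val) (src0 m) = x)
      ≤ #(Finset.univ : Finset (Fin T)) := by
        refine Finset.card_le_card_of_injOn f (fun q _ => Finset.mem_univ _) ?_
        intro q hq q' hq' hqq'
        have h1 := (hf q hq).2
        have h2 := (hf q' hq').2
        rw [Finset.mem_coe, Finset.mem_filter] at hq hq'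
        apply Prod.ext
        · rw [hq.2.1, hq'.2.1]
        · rw [h1, h2, hqq']
    _ = T := by simp

/-- The same for right ends. [folklore] -/
theorem card_partners_snd_acquire_le {σ' : Equiv.Perm (Fin (2 ^ m))} (hσ' : NoReturn T σ')
    (x : Fin (2 ^ m)) (i : Fin (T + 1)) (hx : (σ' ^ i.val) (src0 m) ≠ x) :
    #((Rp m T).filter fun q => q.2 = σ' ∧ (q.1 ^ i.val) (src0 m) = x) ≤ T := by
  classical
  have key : ∀ q ∈ (Rp m T).filter (fun q => q.2 = σ' ∧ (q.1 ^ i.val) (src0 m) = x),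
      ∃ k : Fin T, k.val < i.val ∧
        q.1 = transpose σ' ((σ' ^ k.val) (src0 m)) ((σ' ^ (i.val - k.val)).symm x) := by
    intro q hq
    rw [Finset.mem_filter, mem_Rp_iff] at hq
    obtain ⟨⟨hxp, -, hadj⟩, rfl, hxi⟩ := hq
    obtain ⟨k, hk, v, hv, hq1⟩ := adj_symm (noReturn_of_mem_Xp hxp).atZero hadj
    have hσ'' : NoReturn T (transpose q.2 ((q.2 ^ k) (src0 m)) v) := hq1 ▸ noReturn_of_mem_Xp hxp
    have hki : k < i.val := by
      by_contra hle
      push Not at hle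
      apply hx
      rw [← hxi, hq1]
      exact (pow_transpose_prefix hσ'.atZero hk.le hv i.val hle).symm
    refine ⟨⟨k, hk⟩, hki, ?_⟩
    have hlf := line_formula hσ' hk.le hv hσ'' (i.val - k) (by omega) (by have := i.isLt; omega)
    rw [show k + (i.val - k) = i.val by omega, ← hq1, hxi] at hlf
    rw [hq1]
    congr 1
    rw [eq_comm, Equiv.symm_apply_eq]
    exact hlf
  rcases Nat.eq_zero_or_pos T with hT0 | hTpos
  · subst hT0; rw [Rp_zero]; simp
  haveI : Nonempty (Fin T) := ⟨⟨0, hTpos⟩⟩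
  choose! f hf using key
  calc #((Rp m T).filter fun q => q.2 = σ' ∧ (q.1 ^ i.val) (src0 m) = x)
      ≤ #(Finset.univ : Finset (Fin T)) := by
        refine Finset.card_le_card_of_injOn f (fun q _ => Finset.mem_univ _) ?_
        intro q hq q' hq' hqq'
        have h1 := (hf q hq).2
        have h2 := (hf q' hq').2
        rw [Finset.mem_coe, Finset.mem_filter] at hq hq'
        apply Prod.ext
        · rw [h1, h2, hqq']
        · rw [hq.2.1, hq'.2.1]
    _ = T := by simp

section Degree

variable (T)

/-- The first `2T+1` vertices of the line, as a set of names. [folklore] -/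
def pref (σ : Equiv.Perm (Fin (2 ^ m))) : Finset (Fin (2 ^ m)) :=
  (Finset.range (2 * T + 1)).image fun j => (σ ^ j) (src0 m)

/-- The partner vertex `v = σ^{-(T-k)} w` (so that the new sink is `w`). [folklore] -/
def vOf (σ : Equiv.Perm (Fin (2 ^ m))) (k : ℕ) (w : Fin (2 ^ m)) : Fin (2 ^ m) :=
  (σ ^ (T - k)).symm w

/-- The partner permutation for `(k, w)`. [folklore] -/
def partner (σ : Equiv.Perm (Fin (2 ^ m))) (k : ℕ) (w : Fin (2 ^ m)) : Equiv.Perm (Fin (2 ^ m)) :=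
  transpose σ ((σ ^ k) (src0 m)) (vOf T σ k w)

variable {T}

/-- The prefix has at most `2T+1` names. [folklore] -/
theorem card_pref_le (σ : Equiv.Perm (Fin (2 ^ m))) : #(pref T σ) ≤ 2 * T + 1 :=
  (Finset.card_image_le).trans (by simp)

/-- `x_n ∈ pref` for `n ≤ 2T`. [folklore] -/
theorem pow_mem_pref (σ : Equiv.Perm (Fin (2 ^ m))) {n : ℕ} (hn : n ≤ 2 * T) :
    (σ ^ n) (src0 m) ∈ pref T σ :=
  Finset.mem_image.2 ⟨n, Finset.mem_range.2 (by omega), rfl⟩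

/-- `σ^(T-k) v = w`. [folklore] -/
theorem pow_vOf (σ : Equiv.Perm (Fin (2 ^ m))) (k : ℕ) (w : Fin (2 ^ m)) :
    (σ ^ (T - k)) (vOf T σ k w) = w :=
  Equiv.apply_symm_apply _ _

variable {σ : Equiv.Perm (Fin (2 ^ m))} {k : ℕ} {w : Fin (2 ^ m)}

/-- L1: `v` is off the prefix `x_0, …, x_k`. [folklore] -/
theorem vOf_not_prefix (hk : k ≤ T) (hw : w ∉ pref T σ) : ∀ j ≤ k, (σ ^ j) (src0 m) ≠ vOf T σ k w := by
  intro j hj heq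
  apply hw
  have : w = (σ ^ (T - k + j)) (src0 m) := by
    rw [← pow_vOf (T := T) σ k w, ← heq, ← Equiv.Perm.mul_apply, ← pow_add]
  rw [this]
  exact pow_mem_pref σ (by omega)

/-- L2 (A): `x_k` does not reach `v` within `T` steps. [folklore] -/
theorem distA (hk : k ≤ T) (hw : w ∉ pref T σ) :
    ∀ j : ℕ, 1 ≤ j → j ≤ T → (σ ^ j) ((σ ^ k) (src0 m)) ≠ vOf T σ k w := by
  intro j _ hj heq
  apply hw
  have : w = (σ ^ (T - k + j + k)) (src0 m) := by
    rw [← pow_vOf (T := T) σ k w, ← heq, ← Equiv.Perm.mul_apply, ← Equiv.Perm.mul_apply,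
      ← pow_add, ← pow_add]
  rw [this]
  exact pow_mem_pref σ (by omega)

/-- L3 (B): `v` does not reach `x_k` within `T` steps. [folklore] -/
theorem distB (hk : k ≤ T) (hw : w ∉ pref T σ) :
    ∀ j : ℕ, 1 ≤ j → j ≤ T → (σ ^ j) (vOf T σ k w) ≠ (σ ^ k) (src0 m) := by
  intro j _ hj heq
  apply hw
  set v := vOf T σ k w with hv
  have hwv : w = (σ ^ (T - k)) v := (pow_vOf (T := T) σ k w).symm
  rcases le_or_gt j k with hjk | hjk
  · -- v = σ^(k-j) 0
    have h1 : (σ ^ j) v = (σ ^ j) ((σ ^ (k - j)) (src0 m)) := by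
      rw [heq, ← Equiv.Perm.mul_apply, ← pow_add, show j + (k - j) = k by omega]
    have h2 : v = (σ ^ (k - j)) (src0 m) := (σ ^ j).injective h1
    have : w = (σ ^ (T - k + (k - j))) (src0 m) := by
      rw [hwv, h2, ← Equiv.Perm.mul_apply, ← pow_add]
    rw [this]
    exact pow_mem_pref σ (by omega)
  · -- σ^(j-k) v = 0
    have h1 : (σ ^ k) ((σ ^ (j - k)) v) = (σ ^ k) (src0 m) := by
      rw [← Equiv.Perm.mul_apply, ← pow_add, show k + (j - k) = j by omega, heq]
    have h2 : (σ ^ (j - k)) v = src0 m := (σ ^ k).injective h1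
    have : w = (σ ^ (T - j)) (src0 m) := by
      rw [hwv, ← h2, ← Equiv.Perm.mul_apply, ← pow_add, show T - j + (j - k) = T - k by omega]
    rw [this]
    exact pow_mem_pref σ (by omega)

/-- L4: the partner is in the long-cycle family. [folklore] -/
theorem noReturn_partner (hσ : NoReturn T σ) (hk : k ≤ T) (hw : w ∉ pref T σ) :
    NoReturn T (partner T σ k w) :=
  noReturn_transpose hσ (distA hk hw) (distB hk hw)

/-- L5: the partner's sink is `w`. [folklore] -/
theorem sink_partner (hσ : NoReturn T σ) (hk : k < T) (hw : w ∉ pref T σ) :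
    ((partner T σ k w) ^ T) (src0 m) = w := by
  have h := line_formula hσ hk.le (vOf_not_prefix hk.le hw) (noReturn_partner hσ hk.le hw)
    (T - k) (by omega) (by omega)
  rw [show k + (T - k) = T by omega] at h
  rw [partner, h]
  exact pow_vOf σ k w

/-- L7: the partner is adjacent. [folklore] -/
theorem adj_partner (hk : k < T) (hw : w ∉ pref T σ) : Adj T σ (partner T σ k w) :=
  ⟨k, hk, vOf T σ k w, vOf_not_prefix hk.le hw, rfl⟩

/-- L8a: the partner's line at `k+1` is `σ v ≠ x_{k+1}`. [folklore] -/
theorem partner_pow_succ (hσ : NoReturn T σ) (hk : k < T) (hw : w ∉ pref T σ) :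
    ((partner T σ k w) ^ (k + 1)) (src0 m) = σ (vOf T σ k w) ∧
      ((partner T σ k w) ^ (k + 1)) (src0 m) ≠ (σ ^ (k + 1)) (src0 m) := by
  have h := permLine_transpose_succ (σ := σ) (k := k) (v := vOf T σ k w)
    (prefix_ne_of_noReturnAtZero hσ.atZero hk.le) (fun j hj => vOf_not_prefix hk.le hw j hj.le)
  refine ⟨h, ?_⟩
  rw [partner, h, pow_succ', Equiv.Perm.mul_apply]
  intro heq
  exact vOf_not_prefix hk.le hw k le_rfl (σ.injective heq).symm

/-- L8b: prefix agreement of the partner's line. [folklore] -/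
theorem partner_pow_prefix (hσ : NoReturn T σ) (hk : k < T) (hw : w ∉ pref T σ) :
    ∀ j ≤ k, ((partner T σ k w) ^ j) (src0 m) = (σ ^ j) (src0 m) :=
  pow_transpose_prefix hσ.atZero hk.le (vOf_not_prefix hk.le hw)

/-- L8: `(k, w) ↦ partner` is injective on `k < T`, `w ∉ pref`. [folklore] -/
theorem partner_injective (hσ : NoReturn T σ) {k k' : ℕ} (hk : k < T) (hk' : k' < T)
    {w w' : Fin (2 ^ m)} (hw : w ∉ pref T σ) (hw' : w' ∉ pref T σ)
    (h : partner T σ k w = partner T σ k' w') : k = k' ∧ w = w' := by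
  have hww : w = w' := by
    rw [← sink_partner hσ hk hw, ← sink_partner hσ hk' hw', h]
  refine ⟨?_, hww⟩
  by_contra hne
  rcases lt_or_gt_of_ne hne with hlt | hlt
  · -- k < k': position k+1 ≤ k' is in the prefix of partner k' w'
    have h1 := (partner_pow_succ hσ hk hw).2
    have h2 := partner_pow_prefix hσ hk' hw' (k + 1) (by omega)
    rw [h] at h1
    exact h1 h2
  · have h1 := (partner_pow_succ hσ hk' hw').2
    have h2 := partner_pow_prefix hσ hk hw (k' + 1) (by omega)
    rw [← h] at h1
    exact h1 h2

/-- The odd and the even names. [folklore] -/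
def parNames (m b : ℕ) : Finset (Fin (2 ^ m)) := Finset.univ.filter fun w => w.val % 2 = b

/-- `2^m = 2 · 2^(m-1)` for `m ≥ 1`. [folklore] -/
theorem two_pow_eq_two_mul' (hm : 1 ≤ m) : 2 ^ m = 2 * 2 ^ (m - 1) := by
  obtain ⟨m', rfl⟩ : ∃ m', m = m' + 1 := ⟨m - 1, by omega⟩
  rw [Nat.add_sub_cancel, pow_succ, mul_comm]

/-- There are `2^(m-1)` names of each parity (`m ≥ 1`). [folklore] -/
theorem card_parNames (hm : 1 ≤ m) {b : ℕ} (hb : b < 2) : #(parNames m b) = 2 ^ (m - 1) := by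
  classical
  have h2 := two_pow_eq_two_mul' hm
  -- `y ↦ 2y + b` is a bijection from Fin 2^(m-1) onto the names of parity b
  let f : Fin (2 ^ (m - 1)) → Fin (2 ^ m) := fun y => ⟨2 * y.val + b, by omega⟩
  have hf : Function.Injective f := by
    intro y y' h
    have := Fin.mk.inj_iff.1 h
    exact Fin.ext (by omega)
  have himg : (Finset.univ : Finset (Fin (2 ^ (m - 1)))).image f = parNames m b := by
    ext w
    simp only [Finset.mem_image, Finset.mem_univ, true_and, parNames, Finset.mem_filter]
    constructor
    · rintro ⟨y, rfl⟩
      show (2 * y.val + b) % 2 = b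
      omega
    · intro hw
      refine ⟨⟨w.val / 2, ?_⟩, Fin.ext ?_⟩
      · have := w.isLt; omega
      · show 2 * (w.val / 2) + b = w.val
        omega
  rw [← himg, Finset.card_image_of_injective _ hf, Finset.card_univ, Fintype.card_fin]

/-- `2^m / 2 = 2^(m-1)` in `ℝ` (`m ≥ 1`). [folklore] -/
theorem real_two_pow_div_two (hm : 1 ≤ m) : (2 : ℝ) ^ m / 2 = ((2 ^ (m - 1) : ℕ) : ℝ) := by
  obtain ⟨m', rfl⟩ : ∃ m', m = m' + 1 := ⟨m - 1, by omega⟩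
  rw [Nat.add_sub_cancel]
  push_cast
  rw [pow_succ]
  ring

/-- **THE DEGREE COUNT (left ends).** [folklore] -/
theorem degree_fst {σ : Equiv.Perm (Fin (2 ^ m))} (hm : 1 ≤ m) (hσX : σ ∈ Xp m T) :
    (T : ℝ) * ((2 : ℝ) ^ m / 2 - 2 * T - 1) ≤ #((Rp m T).filter fun p => p.1 = σ) := by
  classical
  have hσ := noReturn_of_mem_Xp hσX
  -- domain: k < T, w odd and outside the prefix
  set W : Finset (Fin (2 ^ m)) := parNames m 1 \ pref T σ with hW
  set D : Finset (Fin T × Fin (2 ^ m)) := Finset.univ ×ˢ W with hD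
  have hinj : Set.InjOn (fun kw : Fin T × Fin (2 ^ m) => (σ, partner T σ kw.1.val kw.2)) ↑D := by
    rintro ⟨k, w⟩ hkw ⟨k', w'⟩ hkw' h
    rw [Finset.mem_coe, hD, Finset.mem_product, hW, Finset.mem_sdiff] at hkw hkw'
    have h' : partner T σ k.val w = partner T σ k'.val w' := congrArg Prod.snd h
    obtain ⟨hkk, hww⟩ := partner_injective hσ k.isLt k'.isLt hkw.2.2 hkw'.2.2 h'
    exact Prod.ext (Fin.ext hkk) hww
  have hmaps : ∀ kw ∈ D, (σ, partner T σ kw.1.val kw.2) ∈ (Rp m T).filter fun p => p.1 = σ := by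
    rintro ⟨k, w⟩ hkw
    rw [hD, Finset.mem_product, hW, Finset.mem_sdiff] at hkw
    obtain ⟨-, hwodd, hwpref⟩ := hkw
    rw [Finset.mem_filter, mem_Rp_iff]
    refine ⟨⟨hσX, ?_, adj_partner k.isLt hwpref⟩, rfl⟩
    -- partner ∈ Yp
    unfold Yp
    rw [Finset.mem_filter, mem_LC_iff]
    refine ⟨noReturn_partner hσ k.isLt.le hwpref, ?_⟩
    unfold sinkParity
    rw [sink_partner hσ k.isLt hwpref]
    unfold parNames at hwodd
    exact (Finset.mem_filter.1 hwodd).2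
  have hcard : #D ≤ #((Rp m T).filter fun p => p.1 = σ) :=
    Finset.card_le_card_of_injOn _ hmaps hinj
  -- #D = T · #W ≥ T (2^(m-1) - (2T+1))
  have hDcard : #D = T * #W := by rw [hD, Finset.card_product, Finset.card_univ, Fintype.card_fin]
  have hWcard : 2 ^ (m - 1) ≤ #W + (2 * T + 1) := by
    rw [hW]
    calc 2 ^ (m - 1) = #(parNames m 1) := (card_parNames hm (by norm_num)).symm
      _ ≤ #(parNames m 1 \ pref T σ) + #(pref T σ) := Finset.card_le_card_sdiff_add_card
      _ ≤ _ := Nat.add_le_add_left (card_pref_le σ) _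
  have hWR : (2 : ℝ) ^ m / 2 - 2 * T - 1 ≤ #W := by
    rw [real_two_pow_div_two hm]
    have : ((2 ^ (m - 1) : ℕ) : ℝ) ≤ #W + (2 * T + 1) := by exact_mod_cast hWcard
    linarith
  calc (T : ℝ) * ((2 : ℝ) ^ m / 2 - 2 * T - 1) ≤ T * #W := by
        apply mul_le_mul_of_nonneg_left hWR (by positivity)
    _ = #D := by rw [hDcard]; push_cast; ring
    _ ≤ _ := by exact_mod_cast hcard

/-- **THE DEGREE COUNT (right ends)**, by the same construction from the right end and symmetry. [folklore] -/
theorem degree_snd {σ' : Equiv.Perm (Fin (2 ^ m))} (hm : 1 ≤ m) (hσY : σ' ∈ Yp m T) :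
    (T : ℝ) * ((2 : ℝ) ^ m / 2 - 2 * T - 1) ≤ #((Rp m T).filter fun p => p.2 = σ') := by
  classical
  have hσ := noReturn_of_mem_Yp hσY
  set W : Finset (Fin (2 ^ m)) := parNames m 0 \ pref T σ' with hW
  set D : Finset (Fin T × Fin (2 ^ m)) := Finset.univ ×ˢ W with hD
  have hinj : Set.InjOn (fun kw : Fin T × Fin (2 ^ m) => (partner T σ' kw.1.val kw.2, σ')) ↑D := by
    rintro ⟨k, w⟩ hkw ⟨k', w'⟩ hkw' h
    rw [Finset.mem_coe, hD, Finset.mem_product, hW, Finset.mem_sdiff] at hkw hkw'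
    have h' : partner T σ' k.val w = partner T σ' k'.val w' := congrArg Prod.fst h
    obtain ⟨hkk, hww⟩ := partner_injective hσ k.isLt k'.isLt hkw.2.2 hkw'.2.2 h'
    exact Prod.ext (Fin.ext hkk) hww
  have hmaps : ∀ kw ∈ D, (partner T σ' kw.1.val kw.2, σ') ∈ (Rp m T).filter fun p => p.2 = σ' := by
    rintro ⟨k, w⟩ hkw
    rw [hD, Finset.mem_product, hW, Finset.mem_sdiff] at hkw
    obtain ⟨-, hweven, hwpref⟩ := hkw
    rw [Finset.mem_filter, mem_Rp_iff]
    refine ⟨⟨?_, hσY, ?_⟩, rfl⟩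
    · unfold Xp
      rw [Finset.mem_filter, mem_LC_iff]
      refine ⟨noReturn_partner hσ k.isLt.le hwpref, ?_⟩
      unfold sinkParity
      rw [sink_partner hσ k.isLt hwpref]
      unfold parNames at hweven
      exact (Finset.mem_filter.1 hweven).2
    · exact adj_symm hσ.atZero (adj_partner k.isLt hwpref)
  have hcard : #D ≤ #((Rp m T).filter fun p => p.2 = σ') :=
    Finset.card_le_card_of_injOn _ hmaps hinj
  have hDcard : #D = T * #W := by rw [hD, Finset.card_product, Finset.card_univ, Fintype.card_fin]
  have hWcard : 2 ^ (m - 1) ≤ #W + (2 * T + 1) := by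
    rw [hW]
    calc 2 ^ (m - 1) = #(parNames m 0) := (card_parNames hm (by norm_num)).symm
      _ ≤ #(parNames m 0 \ pref T σ') + #(pref T σ') := Finset.card_le_card_sdiff_add_card
      _ ≤ _ := Nat.add_le_add_left (card_pref_le σ') _
  have hWR : (2 : ℝ) ^ m / 2 - 2 * T - 1 ≤ #W := by
    rw [real_two_pow_div_two hm]
    have : ((2 ^ (m - 1) : ℕ) : ℝ) ≤ #W + (2 * T + 1) := by exact_mod_cast hWcard
    linarith
  calc (T : ℝ) * ((2 : ℝ) ^ m / 2 - 2 * T - 1) ≤ T * #W := by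
        apply mul_le_mul_of_nonneg_left hWR (by positivity)
    _ = #D := by rw [hDcard]; push_cast; ring
    _ ≤ _ := by exact_mod_cast hcard

end Degree

end Summit.QuantumAdvantage.QuantumAdvantage.Theorems.WbwVerifiableLineNoSpeedup.Negative.Adversary
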